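import Summits.CriticalPhenomena.PercolationContinuityZ3.Theorems.PercNearOneGluingNoHeavyConstsMDLXJoint
import Literature.Probability.Percolation.TwoSetConditionalAssociation
import Literature.Probability.Percolation.TwoClusterConditionalAssociation
import HarnessLib

/-!
# The marker-cluster decomposition of the owner's cluster: combinatorial lemmas (PAPER-2 track (ii); seat `prim-consts-2`, gen 17)

builds on p205010 (kernel theorem, internal audit signed; external expert review pending).  Support file (`--supports
stmt-CriticalPhenomena-4575`); memo `run/shared/lean/prim/consts/FROM-prim-consts-2-g17-CYLINDER-DUALITY.md` §8 (the reduction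
`Consts.MDLXJoint ⟸ J_y`, its exhaustive census, and the formalization blueprint of which this file is step (1)).  No definitions, no named
facts, no sorries; standard axioms.

Setting: owner `s`, marker `y ≠ s`, configuration `ω`.  The MARKER CLUSTER OFF THE OWNER is
`L(ω) = {v | y ↔ v in ω ∖ st(s)}`, `st(s) = {e | s ∈ e}` — the vertex set of the open cluster of `y` in the graph with the owner `s`
deleted; `P(L) = {e | e meets L}`; `A(ω) ⇔ ∃ u ∈ L(ω), s(s,u) ∈ ω` (an open pair from the owner into `L(ω)`; `A ⇔ s ↔ y`).
Conditionally on the class `(L, A)` the owner's cluster splits as `C_s(ω) = C_s(ω ∖ P(L)) ⊔ A·{open pairs of P(L) inside L ∪ {s}}`, every event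
`{s↔t}`, `t ∉ L`, is read off `ω ∖ P(L)`, `{s↔v} ⇔ A` for `v ∈ L`, and the class depends on `ω ∩ P(L)` only — so that, given the class, the
marker event `Y` is an independent coin and the remaining cluster is the cluster of `s` in `G − L` (memo §8).

* `Consts.markerOff_not_mem` — `s ∉ L(ω)`.
* `Consts.markerOff_boundary_closed` — a pair `s(u,v)` with `v ∈ L(ω)`, `u ∉ L(ω)`, `u ≠ s` is closed.
* `Consts.not_mem_markerOff_of_reachable_sdiff` — vertices reachable from `s` in `ω ∖ P(L(ω))` lie outside `L(ω)`.
* `Consts.markerOff_reachable_iff_sdiff` — for `t ∉ L(ω)`: `s ↔ t` in `ω` iff `s ↔ t` in `ω ∖ P(L(ω))`.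
* `Consts.markerOff_reachable_mem_iff` — for `v ∈ L(ω)`: `s ↔ v` in `ω` iff `A(ω)`.
* `Consts.markerOff_eq_iff_inter` — `L(ω) = L₀ ⇔ L(ω ∩ P(L₀)) = L₀`.
* `Consts.openEdgeCluster_eq_of_markerOff` — the decomposition of `C_s(ω)` displayed above.
[cite: VandenbergHaggstromKahn2005, §1 pp. 7–8 (conditioning on a cluster), §2.1 Lemma 2.3 (p. 10)]
-/

namespace Summit.CriticalPhenomena.PercolationContinuityZ3.Theorems

open Set Literature.Probability.LatticeModels Literature.Probability.Percolation
open scoped Classical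

namespace Consts

variable {V : Type*}

/-- Adjacency in the open graph from an open pair through two distinct members of it. [folklore] -/
theorem openGraph_adj_of_mem_mem {ω : BondConfig V} {e : Sym2 V} (he : e ∈ ω) {u v : V} (hu : u ∈ e) (hv : v ∈ e)
    (huv : u ≠ v) : (openGraph ω).Adj u v := by
  have : e = s(u, v) := Sym2.eq_of_ne_mem huv hu hv (Sym2.mem_mk_left u v) (Sym2.mem_mk_right u v)
  subst this
  exact (openGraph_adj ω u v).2 ⟨he, huv⟩

/-- `s ∉ L(ω)` (`s ≠ y`): the owner is not in the marker cluster computed with the owner's pairs deleted. [folklore] -/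
theorem markerOff_not_mem {s y : V} (hsy : s ≠ y) (ω : BondConfig V) :
    s ∉ {v : V | (openGraph (ω \ {e : Sym2 V | s ∈ e})).Reachable y v} := by
  intro hs
  have hW : ∀ ⦃a b : V⦄, a ∈ {v : V | v ≠ s} → (openGraph (ω \ {e : Sym2 V | s ∈ e})).Adj a b → b ∈ {v : V | v ≠ s} := by
    intro a b _ hab hb
    have h1 := ((openGraph_adj _ a b).1 hab).1
    exact h1.2 (by rw [mem_setOf_eq, hb]; exact Sym2.mem_mk_right _ _)
  exact TwoSetConditionalAssociation.mem_of_reachable_of_closed hW (show y ∈ {v : V | v ≠ s} from fun h => hsy h.symm) hs rfl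

/-- **The boundary of the marker cluster is closed away from the owner**: if `v ∈ L(ω)`, `u ∉ L(ω)` and `u ≠ s` then `s(u,v) ∉ ω`. [folklore] -/
theorem markerOff_boundary_closed {s y : V} (hsy : s ≠ y) (ω : BondConfig V) {u v : V}
    (hv : v ∈ {v : V | (openGraph (ω \ {e : Sym2 V | s ∈ e})).Reachable y v})
    (hu : u ∉ {v : V | (openGraph (ω \ {e : Sym2 V | s ∈ e})).Reachable y v}) (hus : u ≠ s) : s(u, v) ∉ ω := by
  intro huv
  have hne : u ≠ v := fun h => hu (h ▸ hv)
  have hvs : v ≠ s := fun h => markerOff_not_mem hsy ω (h ▸ hv)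
  have hmem : s(u, v) ∈ ω \ {e : Sym2 V | s ∈ e} := by
    refine ⟨huv, fun h => ?_⟩
    rcases Sym2.mem_iff.1 (h : s ∈ s(u, v)) with h | h
    · exact hus h.symm
    · exact hvs h.symm
  have hadj : (openGraph (ω \ {e : Sym2 V | s ∈ e})).Adj v u :=
    (openGraph_adj _ v u).2 ⟨by rw [Sym2.eq_swap]; exact hmem, hne.symm⟩
  exact hu ((hv : (openGraph _).Reachable y v).trans hadj.reachable)

/-- Vertices reachable from the owner in `ω ∖ P(L(ω))` (the pairs meeting the marker cluster deleted) lie outside `L(ω)`. [folklore] -/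
theorem not_mem_markerOff_of_reachable_sdiff {s y : V} (hsy : s ≠ y) (ω : BondConfig V) {t : V}
    (ht : (openGraph (ω \ {e : Sym2 V | ∃ v ∈ e, v ∈ {v : V | (openGraph (ω \ {e : Sym2 V | s ∈ e})).Reachable y v}})).Reachable s t) :
    t ∉ {v : V | (openGraph (ω \ {e : Sym2 V | s ∈ e})).Reachable y v} := by
  set L : Set V := {v : V | (openGraph (ω \ {e : Sym2 V | s ∈ e})).Reachable y v} with hL
  have hW : ∀ ⦃a b : V⦄, a ∈ Lᶜ → (openGraph (ω \ {e : Sym2 V | ∃ v ∈ e, v ∈ L})).Adj a b → b ∈ Lᶜ := by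
    intro a b _ hab hb
    have h1 := ((openGraph_adj _ a b).1 hab).1
    exact h1.2 ⟨b, Sym2.mem_mk_right a b, hb⟩
  exact TwoSetConditionalAssociation.mem_of_reachable_of_closed hW (show s ∈ Lᶜ from markerOff_not_mem hsy ω) ht

/-- **Connections of the owner outside the marker cluster are read off `ω ∖ P(L)`**: for `t ∉ L(ω)`, `s ↔ t` in `ω` iff `s ↔ t` in the
configuration with all pairs meeting `L(ω)` deleted. [folklore] -/
theorem markerOff_reachable_iff_sdiff {s y : V} (hsy : s ≠ y) (ω : BondConfig V) {t : V}
    (ht : t ∉ {v : V | (openGraph (ω \ {e : Sym2 V | s ∈ e})).Reachable y v}) :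
    (openGraph ω).Reachable s t ↔
      (openGraph (ω \ {e : Sym2 V | ∃ v ∈ e, v ∈ {v : V | (openGraph (ω \ {e : Sym2 V | s ∈ e})).Reachable y v}})).Reachable s t := by
  set L : Set V := {v : V | (openGraph (ω \ {e : Sym2 V | s ∈ e})).Reachable y v} with hL
  refine ⟨fun hst => ?_, fun h => h.mono (openGraph_mono sdiff_subset)⟩
  -- the closed set `S* = {reachable from s off P(L)} ∪ (L if an open owner–L pair exists)`
  set Sstar : Set V := {v | (openGraph (ω \ {e : Sym2 V | ∃ v ∈ e, v ∈ L})).Reachable s v ∨ (v ∈ L ∧ ∃ u ∈ L, s(s, u) ∈ ω)}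
    with hS
  have hW : ∀ ⦃a b : V⦄, a ∈ Sstar → (openGraph ω).Adj a b → b ∈ Sstar := by
    intro a b ha hab
    have hab' := (openGraph_adj ω a b).1 hab
    rcases ha with ha | ⟨haL, hA⟩
    · have haL : a ∉ L := not_mem_markerOff_of_reachable_sdiff hsy ω ha
      by_cases hbL : b ∈ L
      · -- an open pair from `a ∉ L` into `L`: then `a = s`
        have has : a = s := by
          by_contra has
          exact markerOff_boundary_closed hsy ω hbL haL has hab'.1
        subst has
        exact Or.inr ⟨hbL, b, hbL, hab'.1⟩
      · left
        refine ha.trans (SimpleGraph.Adj.reachable ((openGraph_adj _ a b).2 ⟨⟨hab'.1, ?_⟩, hab'.2⟩))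
        rintro ⟨v, hv, hvL⟩
        rcases Sym2.mem_iff.1 hv with rfl | rfl
        · exact haL hvL
        · exact hbL hvL
    · by_cases hbL : b ∈ L
      · exact Or.inr ⟨hbL, hA⟩
      · -- an open pair from `a ∈ L` to `b ∉ L`: then `b = s`
        have hbs : b = s := by
          by_contra hbs
          exact markerOff_boundary_closed hsy ω haL hbL hbs (by rw [Sym2.eq_swap]; exact hab'.1)
        subst hbs
        exact Or.inl (SimpleGraph.Reachable.refl _)
  have hsS : s ∈ Sstar := Or.inl (SimpleGraph.Reachable.refl _)
  rcases TwoSetConditionalAssociation.mem_of_reachable_of_closed hW hsS hst with h | ⟨htL, -⟩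
  · exact h
  · exact absurd htL ht

/-- **Connections of the owner into the marker cluster**: for `v ∈ L(ω)`, `s ↔ v` in `ω` iff some pair from `s` into `L(ω)` is open. [folklore] -/
theorem markerOff_reachable_mem_iff {s y : V} (hsy : s ≠ y) (ω : BondConfig V) {v : V}
    (hv : v ∈ {v : V | (openGraph (ω \ {e : Sym2 V | s ∈ e})).Reachable y v}) :
    (openGraph ω).Reachable s v ↔ ∃ u ∈ {v : V | (openGraph (ω \ {e : Sym2 V | s ∈ e})).Reachable y v}, s(s, u) ∈ ω := by
  set L : Set V := {v : V | (openGraph (ω \ {e : Sym2 V | s ∈ e})).Reachable y v} with hL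
  constructor
  · intro hsv
    -- walk along `S*` as in `markerOff_reachable_iff_sdiff`
    set Sstar : Set V := {v | (openGraph (ω \ {e : Sym2 V | ∃ v ∈ e, v ∈ L})).Reachable s v ∨ (v ∈ L ∧ ∃ u ∈ L, s(s, u) ∈ ω)}
      with hS
    have hW : ∀ ⦃a b : V⦄, a ∈ Sstar → (openGraph ω).Adj a b → b ∈ Sstar := by
      intro a b ha hab
      have hab' := (openGraph_adj ω a b).1 hab
      rcases ha with ha | ⟨haL, hA⟩
      · have haL : a ∉ L := not_mem_markerOff_of_reachable_sdiff hsy ω ha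
        by_cases hbL : b ∈ L
        · have has : a = s := by
            by_contra has
            exact markerOff_boundary_closed hsy ω hbL haL has hab'.1
          subst has
          exact Or.inr ⟨hbL, b, hbL, hab'.1⟩
        · left
          refine ha.trans (SimpleGraph.Adj.reachable ((openGraph_adj _ a b).2 ⟨⟨hab'.1, ?_⟩, hab'.2⟩))
          rintro ⟨w, hw, hwL⟩
          rcases Sym2.mem_iff.1 hw with rfl | rfl
          · exact haL hwL
          · exact hbL hwL
      · by_cases hbL : b ∈ L
        · exact Or.inr ⟨hbL, hA⟩
        · have hbs : b = s := by
            by_contra hbs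
            exact markerOff_boundary_closed hsy ω haL hbL hbs (by rw [Sym2.eq_swap]; exact hab'.1)
          subst hbs
          exact Or.inl (SimpleGraph.Reachable.refl _)
    rcases TwoSetConditionalAssociation.mem_of_reachable_of_closed hW (Or.inl (SimpleGraph.Reachable.refl _) : s ∈ Sstar) hsv
      with h | ⟨-, hA⟩
    · exact absurd hv (not_mem_markerOff_of_reachable_sdiff hsy ω h)
    · exact hA
  · rintro ⟨u, huL, hsu⟩
    have hus : s ≠ u := by
      rintro rfl
      exact markerOff_not_mem hsy ω huL
    have h1 : (openGraph ω).Reachable s u := ((openGraph_adj ω s u).2 ⟨hsu, hus⟩).reachable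
    have h2 : (openGraph ω).Reachable u v :=
      ((huL : (openGraph _).Reachable y u).symm.trans (hv : (openGraph _).Reachable y v)).mono (openGraph_mono sdiff_subset)
    exact h1.trans h2

/-- **The class is determined by the pairs meeting it**: `L(ω) = L₀` iff `L(ω ∩ P(L₀)) = L₀`. [folklore] -/
theorem markerOff_eq_iff_inter {s y : V} (ω : BondConfig V) (L₀ : Set V) :
    {v : V | (openGraph (ω \ {e : Sym2 V | s ∈ e})).Reachable y v} = L₀ ↔
      {v : V | (openGraph ((ω ∩ {e : Sym2 V | ∃ v ∈ e, v ∈ L₀}) \ {e : Sym2 V | s ∈ e})).Reachable y v} = L₀ := by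
  -- generic step: if `L(ζ) = L₀` for a configuration `ζ`, then every `ζ`-walk from `y` off `st(s)` uses pairs meeting `L₀`
  have key : ∀ ζ : BondConfig V, {v : V | (openGraph (ζ \ {e : Sym2 V | s ∈ e})).Reachable y v} = L₀ →
      ∀ v, (openGraph (ζ \ {e : Sym2 V | s ∈ e})).Reachable y v →
        (openGraph ((ζ ∩ {e : Sym2 V | ∃ v ∈ e, v ∈ L₀}) \ {e : Sym2 V | s ∈ e})).Reachable y v := by
    intro ζ hζ v hv
    rw [SimpleGraph.reachable_iff_reflTransGen] at hv
    induction hv with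
    | refl => exact SimpleGraph.Reachable.refl _
    | tail hab hbc ih =>
      rename_i b c
      have hb : b ∈ L₀ := by
        rw [← hζ]; exact (SimpleGraph.reachable_iff_reflTransGen _ _).2 hab
      have hbc' := (openGraph_adj _ b c).1 hbc
      refine ih.trans (SimpleGraph.Adj.reachable ((openGraph_adj _ b c).2 ⟨⟨⟨hbc'.1.1, b, Sym2.mem_mk_left b c, hb⟩, hbc'.1.2⟩, hbc'.2⟩))
  constructor
  · intro h
    apply Subset.antisymm
    · -- `L(ω ∩ P) ⊆ L(ω) = L₀` by monotonicity
      intro v hv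
      rw [← h]
      exact hv.mono (openGraph_mono (sdiff_subset_sdiff_left inter_subset_left))
    · intro v hv
      have hv' : (openGraph (ω \ {e : Sym2 V | s ∈ e})).Reachable y v := by rw [← h] at hv; exact hv
      exact key ω h v hv'
  · intro h
    apply Subset.antisymm
    · -- `L₀ = L(ω ∩ P)` is closed under adjacency in `ω ∖ st(s)` and contains `y`
      have hW : ∀ ⦃a b : V⦄, a ∈ L₀ → (openGraph (ω \ {e : Sym2 V | s ∈ e})).Adj a b → b ∈ L₀ := by
        intro a b ha hab
        have hab' := (openGraph_adj _ a b).1 hab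
        have ha' : (openGraph ((ω ∩ {e : Sym2 V | ∃ v ∈ e, v ∈ L₀}) \ {e : Sym2 V | s ∈ e})).Reachable y a := by
          rw [← h] at ha; exact ha
        have hadj : (openGraph ((ω ∩ {e : Sym2 V | ∃ v ∈ e, v ∈ L₀}) \ {e : Sym2 V | s ∈ e})).Adj a b :=
          (openGraph_adj _ a b).2 ⟨⟨⟨hab'.1.1, a, Sym2.mem_mk_left a b, ha⟩, hab'.1.2⟩, hab'.2⟩
        have : b ∈ {v : V | (openGraph ((ω ∩ {e : Sym2 V | ∃ v ∈ e, v ∈ L₀}) \ {e : Sym2 V | s ∈ e})).Reachable y v} :=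
          ha'.trans hadj.reachable
        rwa [h] at this
      have hy : y ∈ L₀ := by rw [← h]; exact SimpleGraph.Reachable.refl _
      intro v hv
      exact TwoSetConditionalAssociation.mem_of_reachable_of_closed hW hy hv
    · intro v hv
      rw [← h] at hv
      exact hv.mono (openGraph_mono (sdiff_subset_sdiff_left inter_subset_left))

/-- **The marker-cluster decomposition of the owner's open edge cluster.**  If `L(ω) = L₀` then
`C_s(ω) = C_s(ω ∖ P(L₀)) ∪ {e ∈ ω ∩ P(L₀) | A(ω), e non-diagonal, e ⊆ L₀ ∪ {s}}` (`P(L₀)` = pairs meeting `L₀`,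
`A(ω) ⇔ ∃ u ∈ L₀, s(s,u) ∈ ω`). [cite: VandenbergHaggstromKahn2005, §1 pp. 7–8 — corollary, derived here] -/
theorem openEdgeCluster_eq_of_markerOff {s y : V} (hsy : s ≠ y) (ω : BondConfig V) (L₀ : Set V)
    (hL : {v : V | (openGraph (ω \ {e : Sym2 V | s ∈ e})).Reachable y v} = L₀) :
    openEdgeCluster ω s =
      openEdgeCluster (ω \ {e : Sym2 V | ∃ v ∈ e, v ∈ L₀}) s ∪
        {e | (∃ u ∈ L₀, s(s, u) ∈ ω) ∧ e ∈ ω ∧ (∃ v ∈ e, v ∈ L₀) ∧ ¬ e.IsDiag ∧ ∀ v ∈ e, v ∈ L₀ ∨ v = s} := by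
  subst hL
  set L : Set V := {v : V | (openGraph (ω \ {e : Sym2 V | s ∈ e})).Reachable y v} with hLdef
  ext e
  rw [mem_union, mem_openEdgeCluster_iff, mem_openEdgeCluster_iff, mem_setOf_eq]
  constructor
  · rintro ⟨heω, hed, hreach⟩
    by_cases heP : ∃ v ∈ e, v ∈ L
    · right
      obtain ⟨v, hve, hvL⟩ := heP
      have hA : ∃ u ∈ L, s(s, u) ∈ ω := (markerOff_reachable_mem_iff hsy ω hvL).1 (hreach v hve)
      refine ⟨hA, heω, ⟨v, hve, hvL⟩, hed, fun u hue => ?_⟩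
      by_cases huL : u ∈ L
      · exact Or.inl huL
      · by_cases hus : u = s
        · exact Or.inr hus
        · exfalso
          have hne : u ≠ v := fun h => huL (h ▸ hvL)
          have : e = s(u, v) := Sym2.eq_of_ne_mem hne hue hve (Sym2.mem_mk_left u v) (Sym2.mem_mk_right u v)
          exact markerOff_boundary_closed hsy ω hvL huL hus (this ▸ heω)
    · left
      have heP' : ∀ v ∈ e, v ∉ L := fun v hv hvL => heP ⟨v, hv, hvL⟩
      refine ⟨⟨heω, fun ⟨v, hv, hvL⟩ => heP' v hv hvL⟩, hed, fun v hv => ?_⟩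
      exact (markerOff_reachable_iff_sdiff hsy ω (heP' v hv)).1 (hreach v hv)
  · rintro (⟨⟨heω, -⟩, hed, hreach⟩ | ⟨hA, heω, -, hed, hends⟩)
    · exact ⟨heω, hed, fun v hv => (hreach v hv).mono (openGraph_mono sdiff_subset)⟩
    · refine ⟨heω, hed, fun v hv => ?_⟩
      rcases hends v hv with hvL | rfl
      · exact (markerOff_reachable_mem_iff hsy ω hvL).2 hA
      · exact SimpleGraph.Reachable.refl _

end Consts

end Summit.CriticalPhenomena.PercolationContinuityZ3.Theorems
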